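import Literature.MathematicalPhysics.QuantumFieldTheory.BalabanImbrieJaffe1984to88.BIJ88ConnectedGraphTreeBound
import Literature.MathematicalPhysics.QuantumFieldTheory.BalabanImbrieJaffe1984to88.BIJ88Expansion5143KP

/-!
# `BalabanImbrieJaffe1984to88.BIJ88ConnectedGraphKP310` — T. Bałaban, J. Imbrie, A. Jaffe, *Effective action and cluster properties of the abelian
Higgs model*, Commun. Math. Phys. **114** (1988) 257–315 [BalabanImbrieJaffe1988], Sect. 5.14, pp. 309–310 [PDF 53–54]: **"It is now a standard
exercise to estimate the expansion, using (5.14.4)" FOR THE CONNECTED SERIES OF DISPLAY 3 OF THE ACTUAL (5.14.3) GAS** — the absolute convergence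
`hT` of `Σ_m Tord_m(b)` (every nonempty block `b` of `t`-derivatives) in the VIRTUAL-SUPPORT bookkeeping `(polysOf W).image (cvsupp adj W)` /
`locv loc` / `wv g` of `BIJ88Expansion5143Ordered` (the cluster configurations of (5.14.3): nonoverlapping, no two multi-cube polymers abutting),
DERIVED from an activity bound and then from the typed leaf (5.14.4) `BIJ88Sect5StatementsPart2.Ineq5144` in gen 5's regime, with the bound
`|T(b)| ≤ θ^{(1−β′)|b|}·|b|!·4e²θ^{β′}(Δ+1)·|W|` on the truncated functions.  This is the last displayed hypothesis of p36 gen 10's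
`BIJ88SlotConnectedGraph310` (there: *"NOT proved here … for the virtual-support bookkeeping used here it is not in the tree"*); p25's
`BIJ88RemainderW6Prime.summable_norm_Tord` is the plain-bookkeeping (`polys R Λ`) counterpart.

statement-level skeleton of published theorems with citation tags; proofs where landed; nothing here is a claim about the Yang–Mills mass gap

PDF held: `paper:balaban1988-cmp114-bij-abelian-higgs-effective-action` (journal page = PDF page + 256); p. 309 = PDF 53 (`p0053.txt` L10–14:
*"The {X_β} must cover all cubes connected with the (d/dt)_{γ_j}, j ∈ H. Let us drop the prime, and prove that* (5.14.4) *We use X_β∖H_β to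
denote the set of cubes with no (d/dt)_{γ_j} factors, j ∈ H_β"*), p. 310 = PDF 54 (`p0054.txt` L18: *"where G_c runs over connected graphs
involving all clusters X_γ, Y_δ, and hence all of H"*; L25–26: *"It is now a standard exercise to estimate the expansion, using (5.14.4). The
result is … (We allow adjustments in β, α, β′, keeping them small.)"*), read this session.

WHAT IS REPRODUCED (unit `lit-balaban-p36`, generation 11 of the Phase-2 proof seat p36, file 2 of 3; SKELETON rows **C2.Claim@310** (the
*"standard exercise"* sentence, displays 2–3; member), **C2.Eq5.14.3-5.14.4** ((5.14.4) as the INPUT, member), **C2.Eq5.14.1-5.14.2** (member) of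
`HOME/lit-balaban-r16/ROWS-C2-part2.md`; owner r16, heads untouched; HOME `run/shared/lean/pub/lit-balaban/`).  Setting of p25's gens 10–12
(`BIJ88Expansion5143Ordered`, `BIJ88Expansion5143KP`): cubes `ι` with the abutting relation `adj` (symmetric, degree `≤ Δ` listed by `nbr`), the
polymers `polysOf W` of a region `W`, their virtual supports `cvsupp adj W X` (virtual cubes `ι ⊕ (Finset ι × Finset ι)`), slots `S` located by
`loc`, `locv loc`, activities `g : Finset S → Finset ι → ℝ` pulled back as `wv g`; the tree's animal weight `kpWeight adj σ X = σ^{|X|}·𝟙[X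
adj-connected]`.  Theorems only (0 definitions):
* §1 `kpWeight_mul_pow_le`, `abs_wv_le` (an activity bound `|g(H,X)| ≤ M^{|H|}σ^{|X|}` vanishing off connected polymers pulls back to the virtual
  supports with `u = kpWeight adj σ ∘ cubesOf`), **`vertexHyp_vsupp`** / **`rootHyp_vsupp`** (Dimock's tree-graph hypotheses for the
  cluster-configuration gas with the VOLUME `vol = |cubesOf ·|`: overlapping virtual supports = `cinc`-incompatible = equal or touching polymers,
  p25's `touches_of_cinc`, then the lattice-animal bound `LatticeModels.sum_kpWeight_le_of_touches`; constant `A = 2e²σ(Δ+1)`, `B = |W|`),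
  **`sum_abs_Tord_vsupp_le`**, **`summable_norm_Tord_vsupp`**, **`abs_Tsum_vsupp_le`** (file 1's generic theorems instantiated: under
  `(Δ+1)²eσ ≤ 1/2`, `2e²σ(Δ+1) ≤ 1/8`, `Σ_{m<N}|Tord_m(b)| ≤ M^{|b|}|b|!·4e²σ(Δ+1)|W|`, summability, `|T(b)|` bound).
* §2 FROM (5.14.4): `abs_prime_g3_le_of_ineq5144` (the leaf, VERBATIM in p25 gen 12's phrasing `Ineq5144 (cubeSys ι) (Finset S) (prime (g3 adj zr))
  card (fun H X => (X ∖ H.image loc).card) θ β′`, gives `|g₃′(H,X)| ≤ (θ^{1−β′})^{|H|}(θ^{β′})^{|X|}` since `|X_β∖H_β| ≥ |X_β| − |H_β|`),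
  `prime_g3_eq_zero_of_not_isRConnected` (p25's *"cover and connect"*), `regime_split` (gen 5's regime `16(Δ+1)²θ^{β′/2}e² ≤ 1` ⟹ both smallness
  constants for `σ = θ^{β′}`), **`sum_abs_Tord_vsupp_le_of_ineq5144`**, **`summable_norm_Tord_vsupp_of_ineq5144`** (= `hT` DISCHARGED modulo the
  leaf), **`abs_Tsum_vsupp_le_of_ineq5144`** (`|T(b)| ≤ θ^{(1−β′)|b|}·|b|!·4e²θ^{β′}(Δ+1)·|W|`).
HONEST SCOPE: (a) (5.14.4) is NOT proved — it is the typed leaf (row C2.Eq5.14.3-5.14.4; its proof is the analytic pp. 307/309 estimate); (b) the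
`|X|`-decay form `θ^{n̄+1+β′|X|}` of the printed *"result"* for `W₆′` is gen 5's `BIJ88W6PrimeBound` (plain bookkeeping) and is not re-derived
here; (c) constants not optimized.  0 `sorry`, 0 definitions, 0 new `Prop` facts (D-0026); imports `BIJ88ConnectedGraphTreeBound` (file 1),
`BIJ88Expansion5143KP`; modifies nothing.  NOT summit progress; NOT continuum; NOT Clay.  Cell `lit-balaban` Phase 2, seat p36 gen 11 (owner
r16, referee ref-5).
-/

noncomputable section

namespace Literature.MathematicalPhysics.QuantumFieldTheory.BalabanImbrieJaffe1984to88.BIJ88ConnectedGraphKP310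

open Finset
open Literature.Probability.LatticeModels (IsRConnected Touches kpWeight kpWeight_nonneg sum_kpWeight_le_of_touches)
open BIJ88ConnectedGraphResummation (Tord Tsum)
open BIJ88ConnectedGraphTreeBound (sum_abs_Tord_le_of_treeHyp summable_norm_Tord_of_treeHyp abs_Tsum_le_of_treeHyp)
open BIJ88Expansion5143 (prime g3)
open BIJ88Expansion5143Ordered (polysOf cinc cvsupp locv wv cubesOf cubesOf_vsupp wv_vsupp disjoint_vsupp_iff)
open BIJ88VirtualSupports310 (vsupp_injective)
open BIJ88Expansion5143Obs (mem_polysOf)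
open BIJ88Expansion5143KP (touches_of_cinc isRConnected_of_prime_g3_ne_zero)
open BIJ88Ineq5113Covering (cubeSys)
open BIJ88Sect5StatementsPart2 (Ineq5144)

/-! ## §1 The cluster-configuration gas of (5.14.3): the tree-graph hypotheses on the virtual supports of the polymers of `W` -/

section VSupp

variable {ι : Type*} [DecidableEq ι] [Fintype ι] {S : Type*} [DecidableEq S] [Fintype S] {adj : ι → ι → Prop} [DecidableRel adj]
  {nbr : ι → Finset ι} {Δ : ℕ} {W : Finset ι} {loc : S → ι} {g : Finset S → Finset ι → ℝ}

omit [DecidableEq ι] [Fintype ι] [DecidableEq S] [Fintype S] [DecidableRel adj] in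
/-- `μ_σ(X)·|X|^k ≤ k!·μ_{eσ}(X)` for the animal weight `μ_λ(X) = λ^{|X|}·𝟙[X connected]` (`|X|^k ≤ k!·e^{|X|}`, the vertex arithmetic of the
standard exercise). [cite: BalabanImbrieJaffe1988, p.310 (Sect. 5.14)] -/
theorem kpWeight_mul_pow_le {σ : ℝ} (hσ : 0 ≤ σ) (X : Finset ι) (k : ℕ) :
    kpWeight adj σ X * (X.card : ℝ) ^ k ≤ k.factorial * kpWeight adj (Real.exp 1 * σ) X := by
  by_cases hc : IsRConnected adj X
  · simp only [kpWeight, if_pos hc]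
    have h := Real.pow_div_factorial_le_exp (x := (X.card : ℝ)) (Nat.cast_nonneg _) k
    rw [div_le_iff₀ (by positivity)] at h
    calc σ ^ X.card * (X.card : ℝ) ^ k ≤ σ ^ X.card * (Real.exp (X.card : ℝ) * k.factorial) :=
          mul_le_mul_of_nonneg_left h (pow_nonneg hσ _)
      _ = k.factorial * (Real.exp 1 * σ) ^ X.card := by rw [mul_pow, Real.exp_one_pow]; ring
  · simp only [kpWeight, if_neg hc, zero_mul, mul_zero, le_refl]

omit [DecidableEq S] [Fintype S] in
/-- **the activity bound pulls back to the virtual supports**: if the activities vanish off the `adj`-connected polymers of `W` and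
`|g(H, X)| ≤ M^{|H|}·σ^{|X|}`, then on the virtual supports `|wv g (H, Z̃)| ≤ M^{|H|}·μ_σ(cubes of Z̃)`. [cite: BalabanImbrieJaffe1988, (5.14.4) p.309; p.310] -/
theorem abs_wv_le {M σ : ℝ} (hg0 : ∀ X ∈ polysOf W, ¬ IsRConnected adj X → ∀ H, g H X = 0)
    (hg : ∀ H : Finset S, ∀ X ∈ polysOf W, |g H X| ≤ M ^ H.card * σ ^ X.card) (H : Finset S) :
    ∀ Zv ∈ (polysOf W).image (cvsupp adj W), |wv g H Zv| ≤ M ^ H.card * kpWeight adj σ (cubesOf Zv) := by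
  intro Zv hZv
  obtain ⟨X, hX, rfl⟩ := mem_image.1 hZv
  rw [wv_vsupp, cubesOf_vsupp]
  by_cases hc : IsRConnected adj X
  · simp only [kpWeight, if_pos hc]
    exact hg H X hX
  · simp only [kpWeight, if_neg hc, hg0 X hX hc H, abs_zero, mul_zero, le_refl]

omit [DecidableEq S] [Fintype S] in
/-- **the vertex hypothesis for the cluster-configuration gas**: two virtual supports overlap iff the polymers are `cinc`-incompatible,
hence equal or touching (`BIJ88Expansion5143KP.touches_of_cinc`); so for `adj` symmetric of degree `≤ Δ` and `(Δ+1)²eσ ≤ 1/2` the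
lattice-animal bound `LatticeModels.sum_kpWeight_le_of_touches` gives `Σ_{Z̃ overlapping Z̃′} e·μ_σ·|cubes|^k ≤ k!·(2e²σ(Δ+1))·|cubes of Z̃′|`.
[cite: BalabanImbrieJaffe1988, p.310 (Sect. 5.14)] -/
theorem vertexHyp_vsupp (hR : ∀ x y, adj x y → adj y x) (hΔ : ∀ x, (nbr x).card ≤ Δ) (hnbr : ∀ x y, adj x y → y ∈ nbr x)
    {σ : ℝ} (hσ : 0 ≤ σ) (hsmall : ((Δ : ℝ) + 1) ^ 2 * (Real.exp 1 * σ) ≤ 1 / 2) :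
    ∀ Zv' ∈ (polysOf W).image (cvsupp adj W), ∀ k : ℕ,
      ∑ Zv ∈ (polysOf W).image (cvsupp adj W) with ¬ Disjoint Zv Zv',
          Real.exp 1 * kpWeight adj σ (cubesOf Zv) * ((cubesOf Zv).card : ℝ) ^ k ≤
        k.factorial * (2 * Real.exp 2 * σ * ((Δ : ℝ) + 1)) * ((cubesOf Zv').card : ℝ) := by
  classical
  intro Zv' hZv' k
  obtain ⟨X', hX', rfl⟩ := mem_image.1 hZv'
  rw [cubesOf_vsupp]
  set F : Finset (Finset ι) := (polysOf W).filter fun X => ¬ Disjoint (cvsupp adj W X) (cvsupp adj W X') with hF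
  have h𝒩 : ∀ Y ∈ F, Y = X' ∨ Touches adj X' Y := fun Y hY => by
    obtain ⟨hY, hd⟩ := mem_filter.1 hY
    rw [disjoint_vsupp_iff hY hX', not_not] at hd
    exact touches_of_cinc hR hd
  have he2 : Real.exp 2 = Real.exp 1 * Real.exp 1 := by rw [← Real.exp_add]; norm_num
  calc ∑ Zv ∈ ((polysOf W).image (cvsupp adj W)) with ¬ Disjoint Zv (cvsupp adj W X'),
          Real.exp 1 * kpWeight adj σ (cubesOf Zv) * ((cubesOf Zv).card : ℝ) ^ k
      = ∑ X ∈ F, Real.exp 1 * kpWeight adj σ X * (X.card : ℝ) ^ k := by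
        rw [hF, Finset.filter_image, sum_image fun X _ Y _ h => vsupp_injective h]
        exact sum_congr rfl fun X _ => by rw [cubesOf_vsupp]
    _ ≤ ∑ X ∈ F, Real.exp 1 * (k.factorial * kpWeight adj (Real.exp 1 * σ) X) :=
        sum_le_sum fun X _ => by
          rw [mul_assoc]
          exact mul_le_mul_of_nonneg_left (kpWeight_mul_pow_le hσ X k) (Real.exp_nonneg 1)
    _ = Real.exp 1 * k.factorial * ∑ X ∈ F, kpWeight adj (Real.exp 1 * σ) X := by
        rw [mul_sum]
        exact sum_congr rfl fun _ _ => by ring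
    _ ≤ Real.exp 1 * k.factorial * (X'.card * ((Δ : ℝ) + 1) * (2 * (Real.exp 1 * σ))) :=
        mul_le_mul_of_nonneg_left (sum_kpWeight_le_of_touches hR hΔ hnbr (mul_nonneg (Real.exp_nonneg 1) hσ) hsmall X' F h𝒩)
          (by positivity)
    _ = k.factorial * (2 * Real.exp 2 * σ * ((Δ : ℝ) + 1)) * (X'.card : ℝ) := by
        rw [he2]; ring

omit [DecidableEq S] [Fintype S] [DecidableRel adj] in
/-- **the root hypothesis for the cluster-configuration gas**: every polymer of `W` touches `W`, so `Σ_{Z̃} e·μ_σ·|cubes|^k ≤ k!·(2e²σ(Δ+1))·|W|`.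
[cite: BalabanImbrieJaffe1988, p.310 (Sect. 5.14)] -/
theorem rootHyp_vsupp [DecidableRel adj] (hR : ∀ x y, adj x y → adj y x) (hΔ : ∀ x, (nbr x).card ≤ Δ)
    (hnbr : ∀ x y, adj x y → y ∈ nbr x) {σ : ℝ} (hσ : 0 ≤ σ) (hsmall : ((Δ : ℝ) + 1) ^ 2 * (Real.exp 1 * σ) ≤ 1 / 2) (k : ℕ) :
    ∑ Zv ∈ (polysOf W).image (cvsupp adj W), Real.exp 1 * kpWeight adj σ (cubesOf Zv) * ((cubesOf Zv).card : ℝ) ^ k ≤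
      k.factorial * (2 * Real.exp 2 * σ * ((Δ : ℝ) + 1)) * (W.card : ℝ) := by
  classical
  have h𝒩 : ∀ Y ∈ polysOf W, Y = W ∨ Touches adj W Y := fun Y hY => by
    obtain ⟨hYW, c, hc⟩ := mem_polysOf.1 hY
    exact Or.inr ⟨c, hYW hc, c, hc, Or.inl rfl⟩
  have he2 : Real.exp 2 = Real.exp 1 * Real.exp 1 := by rw [← Real.exp_add]; norm_num
  calc ∑ Zv ∈ (polysOf W).image (cvsupp adj W), Real.exp 1 * kpWeight adj σ (cubesOf Zv) * ((cubesOf Zv).card : ℝ) ^ k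
      = ∑ X ∈ polysOf W, Real.exp 1 * kpWeight adj σ X * (X.card : ℝ) ^ k := by
        rw [sum_image fun X _ Y _ h => vsupp_injective h]
        exact sum_congr rfl fun X _ => by rw [cubesOf_vsupp]
    _ ≤ ∑ X ∈ polysOf W, Real.exp 1 * (k.factorial * kpWeight adj (Real.exp 1 * σ) X) :=
        sum_le_sum fun X _ => by
          rw [mul_assoc]
          exact mul_le_mul_of_nonneg_left (kpWeight_mul_pow_le hσ X k) (Real.exp_nonneg 1)
    _ = Real.exp 1 * k.factorial * ∑ X ∈ polysOf W, kpWeight adj (Real.exp 1 * σ) X := by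
        rw [mul_sum]
        exact sum_congr rfl fun _ _ => by ring
    _ ≤ Real.exp 1 * k.factorial * (W.card * ((Δ : ℝ) + 1) * (2 * (Real.exp 1 * σ))) :=
        mul_le_mul_of_nonneg_left (sum_kpWeight_le_of_touches hR hΔ hnbr (mul_nonneg (Real.exp_nonneg 1) hσ) hsmall W _ h𝒩)
          (by positivity)
    _ = k.factorial * (2 * Real.exp 2 * σ * ((Δ : ℝ) + 1)) * (W.card : ℝ) := by
        rw [he2]; ring

/-- **THE STANDARD EXERCISE FOR THE CONNECTED SERIES OF THE CLUSTER-CONFIGURATION GAS, from an activity bound**: if `adj` is symmetric of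
degree `≤ Δ`, the activities `g(H, X)` vanish off the `adj`-connected polymers of `W` and obey `|g(H, X)| ≤ M^{|H|}·σ^{|X|}` (`M, σ ≥ 0`) with
`(Δ+1)²eσ ≤ 1/2` and `2e²σ(Δ+1) ≤ 1/8`, then for every nonempty `b` and every `N`:
`Σ_{m<N} |Tord_m(b)| ≤ M^{|b|}·|b|!·(4e²σ(Δ+1))·|W|` in the virtual-support bookkeeping `(polysOf W).image (cvsupp adj W)`, `locv loc`, `wv g`.
[cite: BalabanImbrieJaffe1988, p.310 (Sect. 5.14)] -/
theorem sum_abs_Tord_vsupp_le (hR : ∀ x y, adj x y → adj y x) (hΔ : ∀ x, (nbr x).card ≤ Δ) (hnbr : ∀ x y, adj x y → y ∈ nbr x)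
    {M σ : ℝ} (hM : 0 ≤ M) (hσ : 0 ≤ σ) (hsmall₁ : ((Δ : ℝ) + 1) ^ 2 * (Real.exp 1 * σ) ≤ 1 / 2)
    (hsmall₂ : 2 * Real.exp 2 * σ * ((Δ : ℝ) + 1) ≤ 1 / 8)
    (hg0 : ∀ X ∈ polysOf W, ¬ IsRConnected adj X → ∀ H, g H X = 0)
    (hg : ∀ H : Finset S, ∀ X ∈ polysOf W, |g H X| ≤ M ^ H.card * σ ^ X.card) {b : Finset S} (hb : b.Nonempty) (N : ℕ) :
    ∑ m ∈ range N, |Tord ((polysOf W).image (cvsupp adj W)) (locv loc) (wv g) m b| ≤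
      M ^ b.card * b.card.factorial * (2 * (2 * Real.exp 2 * σ * ((Δ : ℝ) + 1)) * W.card) :=
  sum_abs_Tord_le_of_treeHyp (u := fun Zv => kpWeight adj σ (cubesOf Zv)) (vol := fun Zv => ((cubesOf Zv).card : ℝ)) hM
    (fun Zv => kpWeight_nonneg adj hσ _) (fun H Zv hZv => abs_wv_le hg0 hg H Zv hZv) (fun _ _ => Nat.cast_nonneg _)
    (by positivity) (Nat.cast_nonneg _) hsmall₂ (vertexHyp_vsupp hR hΔ hnbr hσ hsmall₁) (rootHyp_vsupp hR hΔ hnbr hσ hsmall₁) hb N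

/-- **… the connected series converges absolutely** (`hT` of `BIJ88SlotConnectedGraph310` in the virtual-support bookkeeping).
[cite: BalabanImbrieJaffe1988, p.310 (Sect. 5.14)] -/
theorem summable_norm_Tord_vsupp (hR : ∀ x y, adj x y → adj y x) (hΔ : ∀ x, (nbr x).card ≤ Δ) (hnbr : ∀ x y, adj x y → y ∈ nbr x)
    {M σ : ℝ} (hM : 0 ≤ M) (hσ : 0 ≤ σ) (hsmall₁ : ((Δ : ℝ) + 1) ^ 2 * (Real.exp 1 * σ) ≤ 1 / 2)
    (hsmall₂ : 2 * Real.exp 2 * σ * ((Δ : ℝ) + 1) ≤ 1 / 8)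
    (hg0 : ∀ X ∈ polysOf W, ¬ IsRConnected adj X → ∀ H, g H X = 0)
    (hg : ∀ H : Finset S, ∀ X ∈ polysOf W, |g H X| ≤ M ^ H.card * σ ^ X.card) {b : Finset S} (hb : b.Nonempty) :
    Summable fun m => ‖Tord ((polysOf W).image (cvsupp adj W)) (locv loc) (wv g) m b‖ :=
  summable_norm_Tord_of_treeHyp (u := fun Zv => kpWeight adj σ (cubesOf Zv)) (vol := fun Zv => ((cubesOf Zv).card : ℝ)) hM
    (fun Zv => kpWeight_nonneg adj hσ _) (fun H Zv hZv => abs_wv_le hg0 hg H Zv hZv) (fun _ _ => Nat.cast_nonneg _)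
    (by positivity) (Nat.cast_nonneg _) hsmall₂ (vertexHyp_vsupp hR hΔ hnbr hσ hsmall₁) (rootHyp_vsupp hR hΔ hnbr hσ hsmall₁) hb

/-- **… and the truncated function of every nonempty block is bounded**: `|T(b)| ≤ M^{|b|}·|b|!·(4e²σ(Δ+1))·|W|`.
[cite: BalabanImbrieJaffe1988, p.310 (Sect. 5.14)] -/
theorem abs_Tsum_vsupp_le (hR : ∀ x y, adj x y → adj y x) (hΔ : ∀ x, (nbr x).card ≤ Δ) (hnbr : ∀ x y, adj x y → y ∈ nbr x)
    {M σ : ℝ} (hM : 0 ≤ M) (hσ : 0 ≤ σ) (hsmall₁ : ((Δ : ℝ) + 1) ^ 2 * (Real.exp 1 * σ) ≤ 1 / 2)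
    (hsmall₂ : 2 * Real.exp 2 * σ * ((Δ : ℝ) + 1) ≤ 1 / 8)
    (hg0 : ∀ X ∈ polysOf W, ¬ IsRConnected adj X → ∀ H, g H X = 0)
    (hg : ∀ H : Finset S, ∀ X ∈ polysOf W, |g H X| ≤ M ^ H.card * σ ^ X.card) {b : Finset S} (hb : b.Nonempty) :
    |Tsum ((polysOf W).image (cvsupp adj W)) (locv loc) (wv g) b| ≤
      M ^ b.card * b.card.factorial * (2 * (2 * Real.exp 2 * σ * ((Δ : ℝ) + 1)) * W.card) :=
  abs_Tsum_le_of_treeHyp (u := fun Zv => kpWeight adj σ (cubesOf Zv)) (vol := fun Zv => ((cubesOf Zv).card : ℝ)) hM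
    (fun Zv => kpWeight_nonneg adj hσ _) (fun H Zv hZv => abs_wv_le hg0 hg H Zv hZv) (fun _ _ => Nat.cast_nonneg _)
    (by positivity) (Nat.cast_nonneg _) hsmall₂ (vertexHyp_vsupp hR hΔ hnbr hσ hsmall₁) (rootHyp_vsupp hR hΔ hnbr hσ hsmall₁) hb

end VSupp

/-! ## §2 From the typed leaf (5.14.4) in gen 5's regime -/

section Leaf

variable {ι : Type} [DecidableEq ι] [Fintype ι] {S : Type} [DecidableEq S] [Fintype S] {adj : ι → ι → Prop} [DecidableRel adj]
  {nbr : ι → Finset ι} {Δ : ℕ} {W : Finset ι} {loc : S → ι} {zr : Finset S → Finset ι → Finset ι → ℝ} {θ β' : ℝ}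

omit [Fintype ι] [Fintype S] [DecidableRel adj] in
/-- **(5.14.4) ⟹ the activity-bound shape**: `|g₃′(H, X)| ≤ θ^{|H| + β′|X∖H|} ≤ (θ^{1−β′})^{|H|}·(θ^{β′})^{|X|}` for `0 < θ ≤ 1`, `β′ ≥ 0`
(`|X_β∖H_β| ≥ |X_β| − |H_β|`). [cite: BalabanImbrieJaffe1988, (5.14.4) p.309] -/
theorem abs_prime_g3_le_of_ineq5144 [DecidableRel adj] (hθ0 : 0 < θ) (hθ1 : θ ≤ 1) (hβ : 0 ≤ β')
    (h : Ineq5144 (cubeSys ι) (Finset S) (prime (g3 adj zr)) Finset.card (fun H (X : Finset ι) => (X \ H.image loc).card) θ β')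
    (H : Finset S) (X : Finset ι) :
    |prime (g3 adj zr) H X| ≤ (θ ^ (1 - β')) ^ H.card * (θ ^ β') ^ X.card := by
  have hX := h H X
  dsimp only at hX
  refine hX.trans ?_
  have hsd : (X.card : ℝ) - H.card ≤ ((X \ H.image loc).card : ℝ) := by
    have h1 := card_sdiff_add_card_inter X (H.image loc)
    have h2 : (X ∩ H.image loc).card ≤ H.card := (card_le_card inter_subset_right).trans card_image_le
    have h3 : X.card ≤ (X \ H.image loc).card + H.card := by omega
    have h4 : (X.card : ℝ) ≤ ((X \ H.image loc).card : ℝ) + H.card := by exact_mod_cast h3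
    linarith
  calc θ ^ ((H.card : ℝ) + β' * ((X \ H.image loc).card : ℝ))
      ≤ θ ^ ((1 - β') * H.card + β' * X.card) :=
        Real.rpow_le_rpow_of_exponent_ge hθ0 hθ1 (by nlinarith)
    _ = (θ ^ (1 - β')) ^ H.card * (θ ^ β') ^ X.card := by
        rw [Real.rpow_add hθ0, Real.rpow_mul hθ0.le, Real.rpow_mul hθ0.le, Real.rpow_natCast, Real.rpow_natCast]

omit [Fintype ι] [Fintype S] in
/-- the prime-dropped activities vanish off the `adj`-connected polymers (p. 309: *"Each X_γ must cover and connect"*;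
`BIJ88Expansion5143KP.isRConnected_of_prime_g3_ne_zero`). [cite: BalabanImbrieJaffe1988, p.309 (Sect. 5.14)] -/
theorem prime_g3_eq_zero_of_not_isRConnected (hR : ∀ x y, adj x y → adj y x) {X : Finset ι} (hX : X ∈ polysOf W)
    (hc : ¬ IsRConnected adj X) (H : Finset S) : prime (g3 adj zr) H X = 0 := by
  by_contra h
  exact hc (isRConnected_of_prime_g3_ne_zero hR zr H (mem_polysOf.1 hX).2 h)

/-- **gen 5's regime gives the two smallness constants of §2** for `σ = θ^{β′}`: `16(Δ+1)²θ^{β′/2}e² ≤ 1`, `0 < θ ≤ 1`, `0 ≤ β′` imply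
`(Δ+1)²·eθ^{β′} ≤ 1/2` and `2e²θ^{β′}(Δ+1) ≤ 1/8` (`θ^{β′} ≤ θ^{β′/2}`, `e ≤ e²`, `Δ+1 ≤ (Δ+1)²`). [cite: BalabanImbrieJaffe1988, p.310 (Sect. 5.14)] -/
theorem regime_split (hθ0 : 0 < θ) (hθ1 : θ ≤ 1) (hβ : 0 ≤ β')
    (hsmall : 16 * ((Δ : ℝ) + 1) ^ 2 * (θ ^ (β' / 2) * Real.exp 2) ≤ 1) :
    ((Δ : ℝ) + 1) ^ 2 * (Real.exp 1 * θ ^ β') ≤ 1 / 2 ∧ 2 * Real.exp 2 * θ ^ β' * ((Δ : ℝ) + 1) ≤ 1 / 8 := by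
  set u : ℝ := θ ^ (β' / 2) with hu
  have hu0 : 0 ≤ u := Real.rpow_nonneg hθ0.le _
  have hu1 : u ≤ 1 := Real.rpow_le_one hθ0.le hθ1 (by linarith)
  have hθβ : θ ^ β' = u ^ 2 := by
    rw [hu, ← Real.rpow_natCast, ← Real.rpow_mul hθ0.le]
    norm_num
  have hu2 : θ ^ β' ≤ u := by rw [hθβ]; nlinarith
  have hθβ0 : 0 ≤ θ ^ β' := Real.rpow_nonneg hθ0.le _
  have he1 : (1 : ℝ) ≤ Real.exp 1 := Real.one_le_exp (by norm_num)
  have he : Real.exp 1 ≤ Real.exp 2 := Real.exp_le_exp.2 (by norm_num)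
  have he0 : 0 ≤ Real.exp 2 := Real.exp_nonneg _
  have hD1 : (1 : ℝ) ≤ (Δ : ℝ) + 1 := by linarith [(Nat.cast_nonneg Δ : (0 : ℝ) ≤ Δ)]
  have hD : (Δ : ℝ) + 1 ≤ ((Δ : ℝ) + 1) ^ 2 := by nlinarith
  have h1 : ((Δ : ℝ) + 1) ^ 2 * u * Real.exp 2 ≤ 1 / 16 := by linarith [hsmall]
  constructor
  · calc ((Δ : ℝ) + 1) ^ 2 * (Real.exp 1 * θ ^ β') ≤ ((Δ : ℝ) + 1) ^ 2 * (Real.exp 2 * u) := by gcongr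
      _ = ((Δ : ℝ) + 1) ^ 2 * u * Real.exp 2 := by ring
      _ ≤ 1 / 2 := by linarith
  · calc 2 * Real.exp 2 * θ ^ β' * ((Δ : ℝ) + 1) ≤ 2 * Real.exp 2 * u * ((Δ : ℝ) + 1) ^ 2 := by gcongr
      _ = 2 * (((Δ : ℝ) + 1) ^ 2 * u * Real.exp 2) := by ring
      _ ≤ 1 / 8 := by linarith

/-- **THE STANDARD EXERCISE FOR THE CONNECTED SERIES OF (5.14.3), FROM (5.14.4)** (p. 310: *"where G_c runs over connected graphs involving
all clusters X_γ, Y_δ, and hence all of H. … It is now a standard exercise to estimate the expansion, using (5.14.4)."*): for REAL corner data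
`zr` whose prime-dropped activities obey the typed leaf (5.14.4) `Ineq5144 (cubeSys ι) (Finset S) (prime (g3 adj zr)) card (H, X ↦ |X∖H|) θ β′`
with `0 < θ ≤ 1`, `0 ≤ β′`, in gen 5's regime `16(Δ+1)²θ^{β′/2}e² ≤ 1` for a symmetric abutting relation of degree `≤ Δ`: for every slot
localization `loc`, every nonempty block `b` and every `N`, `Σ_{m<N} |Tord_m(b)| ≤ θ^{(1−β′)|b|}·|b|!·(4e²θ^{β′}(Δ+1))·|W|` in the
virtual-support bookkeeping of the polymers of `W`. [cite: BalabanImbrieJaffe1988, (5.14.4) p.309, p.310 (Sect. 5.14)] -/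
theorem sum_abs_Tord_vsupp_le_of_ineq5144 (hR : ∀ x y, adj x y → adj y x) (hΔ : ∀ x, (nbr x).card ≤ Δ)
    (hnbr : ∀ x y, adj x y → y ∈ nbr x) (hθ0 : 0 < θ) (hθ1 : θ ≤ 1) (hβ : 0 ≤ β')
    (hsmall : 16 * ((Δ : ℝ) + 1) ^ 2 * (θ ^ (β' / 2) * Real.exp 2) ≤ 1)
    (h : Ineq5144 (cubeSys ι) (Finset S) (prime (g3 adj zr)) Finset.card (fun H (X : Finset ι) => (X \ H.image loc).card) θ β')
    {b : Finset S} (hb : b.Nonempty) (N : ℕ) :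
    ∑ m ∈ range N, |Tord ((polysOf W).image (cvsupp adj W)) (locv loc) (wv (prime (g3 adj zr))) m b| ≤
      (θ ^ (1 - β')) ^ b.card * b.card.factorial * (2 * (2 * Real.exp 2 * θ ^ β' * ((Δ : ℝ) + 1)) * W.card) :=
  have hs := regime_split (Δ := Δ) hθ0 hθ1 hβ hsmall
  sum_abs_Tord_vsupp_le hR hΔ hnbr (Real.rpow_nonneg hθ0.le _) (Real.rpow_nonneg hθ0.le _) hs.1 hs.2
    (fun _ hX hc H => prime_g3_eq_zero_of_not_isRConnected hR hX hc H)
    (fun H X _ => abs_prime_g3_le_of_ineq5144 hθ0 hθ1 hβ h H X) hb N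

/-- **`hT` DISCHARGED FROM (5.14.4)**: in the same regime the connected series `Σ_m Tord_m(b)` of every nonempty block converges absolutely
in the virtual-support bookkeeping — the hypothesis `hT` of `BIJ88SlotConnectedGraph310` (`zG_fD_div_eq_sum_setPartitions_Tsum`,
`trunc_eq_Tsum_of_display2`, `sum_asg_Tsum_eq_iteratedDeriv_log_zG`, `remR_sum_Tsum_eq_integral_log_zG`) and of p25's
`BIJ88RemainderW6Tsum.display2_Tsum` for the (5.14.3) gas. [cite: BalabanImbrieJaffe1988, (5.14.4) p.309, p.310 (Sect. 5.14)] -/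
theorem summable_norm_Tord_vsupp_of_ineq5144 (hR : ∀ x y, adj x y → adj y x) (hΔ : ∀ x, (nbr x).card ≤ Δ)
    (hnbr : ∀ x y, adj x y → y ∈ nbr x) (hθ0 : 0 < θ) (hθ1 : θ ≤ 1) (hβ : 0 ≤ β')
    (hsmall : 16 * ((Δ : ℝ) + 1) ^ 2 * (θ ^ (β' / 2) * Real.exp 2) ≤ 1)
    (h : Ineq5144 (cubeSys ι) (Finset S) (prime (g3 adj zr)) Finset.card (fun H (X : Finset ι) => (X \ H.image loc).card) θ β')
    {b : Finset S} (hb : b.Nonempty) :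
    Summable fun m => ‖Tord ((polysOf W).image (cvsupp adj W)) (locv loc) (wv (prime (g3 adj zr))) m b‖ :=
  have hs := regime_split (Δ := Δ) hθ0 hθ1 hβ hsmall
  summable_norm_Tord_vsupp hR hΔ hnbr (Real.rpow_nonneg hθ0.le _) (Real.rpow_nonneg hθ0.le _) hs.1 hs.2
    (fun _ hX hc H => prime_g3_eq_zero_of_not_isRConnected hR hX hc H)
    (fun H X _ => abs_prime_g3_le_of_ineq5144 hθ0 hθ1 hβ h H X) hb

/-- **THE TRUNCATED FUNCTIONS OF DISPLAY 3 ARE BOUNDED, from (5.14.4)**: `|T(b)| ≤ θ^{(1−β′)|b|}·|b|!·(4e²θ^{β′}(Δ+1))·|W|` for every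
nonempty block `b` — the block estimate behind the printed *"The result is |W₆^{(k)′}(X)| ≤ (e^β(L^kε/ε₀)^{1/4−α})^{n̄+1+β′|X|}"* (whose
`|X|`-decay extraction is gen 5's `BIJ88W6PrimeBound`, plain bookkeeping). [cite: BalabanImbrieJaffe1988, (5.14.4) p.309, p.310 (Sect. 5.14)] -/
theorem abs_Tsum_vsupp_le_of_ineq5144 (hR : ∀ x y, adj x y → adj y x) (hΔ : ∀ x, (nbr x).card ≤ Δ)
    (hnbr : ∀ x y, adj x y → y ∈ nbr x) (hθ0 : 0 < θ) (hθ1 : θ ≤ 1) (hβ : 0 ≤ β')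
    (hsmall : 16 * ((Δ : ℝ) + 1) ^ 2 * (θ ^ (β' / 2) * Real.exp 2) ≤ 1)
    (h : Ineq5144 (cubeSys ι) (Finset S) (prime (g3 adj zr)) Finset.card (fun H (X : Finset ι) => (X \ H.image loc).card) θ β')
    {b : Finset S} (hb : b.Nonempty) :
    |Tsum ((polysOf W).image (cvsupp adj W)) (locv loc) (wv (prime (g3 adj zr))) b| ≤
      (θ ^ (1 - β')) ^ b.card * b.card.factorial * (2 * (2 * Real.exp 2 * θ ^ β' * ((Δ : ℝ) + 1)) * W.card) :=
  have hs := regime_split (Δ := Δ) hθ0 hθ1 hβ hsmall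
  abs_Tsum_vsupp_le hR hΔ hnbr (Real.rpow_nonneg hθ0.le _) (Real.rpow_nonneg hθ0.le _) hs.1 hs.2
    (fun _ hX hc H => prime_g3_eq_zero_of_not_isRConnected hR hX hc H)
    (fun H X _ => abs_prime_g3_le_of_ineq5144 hθ0 hθ1 hβ h H X) hb

end Leaf

end Literature.MathematicalPhysics.QuantumFieldTheory.BalabanImbrieJaffe1984to88.BIJ88ConnectedGraphKP310

end
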